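import Literature.NumberTheory.Sieve.FGKMT2018Theorem6Decomposition
import Literature.NumberTheory.Sieve.FGKMT2018SingularSeriesLowerBound
import Literature.NumberTheory.Sieve.Maynard2016DenseClustersTestFunction
import HarnessLib

/-!
# Maynard 2016, Proposition 6.1 for `𝒜 = ℤ` — DECOMPOSITION into its printed parts

Sources: J. Maynard, *Dense clusters of primes in subsets*, Compositio Math. 152 (2016) 1517–1554 =
arXiv:1405.2593 [Maynard2016DenseClusters], Proposition 6.1 (p. 9), Lemmas 8.1, 8.5, 8.6 (pp. 15–18),
Propositions 9.1, 9.2, 9.4 (pp. 19–26); K. Ford, B. Green, S. Konyagin, J. Maynard, T. Tao, *Long gaps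
between primes*, JAMS 31 (2018) = arXiv:1412.5029v4 [FordGreenKonyaginMaynardTao2018], Theorem 6 and
its proof (pp. 21–22): «The first estimate (7.12) is given by [Maynard, Prop. 9.1], (7.13) follows from
[Maynard, Prop. 9.2] in the case (a_L, B) = 1, (7.14) is given by [Maynard, Prop. 9.4] (taking
ξ := θ/10 and D := 1), and the final statement (7.15) is given by part (iii) of [Maynard, Lemma 8.5].
The bounds for J_k and I_k are given by [Maynard, Lemma 8.6].»

The named fact `Maynard2016DenseClusters_prop61Z` (`FGKMT2018Theorem6Decomposition`) is the last
named input of the large-gaps DAG after `fordGreenKonyaginMaynardTao2018_lemma72_holds`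
(`FGKMT2018Lemma72`). This file splits it, exactly along the printed proof of [FGKMT, Thm 6] quoted
above, into FOUR named leaf statements over the tree's pinned sieve data (`FGKMT2018.sieveWt`,
`mainTermA`, `mainTermB`, `errTermB`, `discDelta`, `singSeriesExcl`) and the pinned smooth function of
[Maynard, §7 (7.4)] (`MaynardDense.F`, with `I_k = MaynardDense.IF k`, `J_k = MaynardDense.JF k` from
`Maynard2016DenseClustersTestFunction`):

* `Maynard2016DenseClusters_prop91Z`   — [Maynard, Prop. 9.1] = (7.12): `∑_{n ∈ 𝒜(X)} w_n`;
* `Maynard2016DenseClusters_prop92Z`   — [Maynard, Prop. 9.2 with Lemma 9.3, case (a_L, B) = 1] =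
  (7.13): `∑ 1_𝒫(L_i(n)) w_n`, guarded by Hypothesis 1 (2) for `L_i` (`HypothesisOneZ`), uniformly in
  the Hypothesis-1 constant `C_H`;
* `Maynard2016DenseClusters_prop94Z`   — [Maynard, Prop. 9.4 at ξ = θ/10 = 1/30, D = 1] = (7.14);
* `Maynard2016DenseClusters_lemma85iiiZ` — [Maynard, Lemma 8.5 (iii)] = (7.15): `w_n ≪ R^{2+o(1)}`,
  i.e. `w_n ≤ X^{2/9+ε}` for `R ≤ X^{1/9}`;

all four stated over ONE shared quantifier block `FGKMT2018.Prop61Frame C P` — verbatim the block of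
`Maynard2016DenseClusters_prop61Z` (`x` large; `B = 1` or prime, `B ≤ x`; `C ≤ k ≤ log^{1/5} x`;
`𝓛` admissible and non-degenerate with `|a_i| ≤ log x`, `|b_i| ≤ x log² x`; `x/2 ≤ X ≤ x log² x`;
`X^{1/30} ≤ R ≤ X^{1/9}`). The two remaining clauses of Prop. 6.1 are ALREADY THEOREMS of the tree:
`𝔖_B(𝓛) ≥ e^{−7k}` (`FGKMT2018.exp_neg_seven_mul_le_singSeriesExcl`, [Maynard, Lemma 8.1]) and the
`I_k, J_k` block with `C = 2^18`, `K = 8` (`MaynardDense.exists_IF_JF_bounds`, [Maynard, Lemma 8.6]).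

`maynard2016_prop61Z_of_parts` PROVES
`prop91Z → prop92Z → prop94Z → lemma85iiiZ → Maynard2016DenseClusters_prop61Z`
(take `F := MaynardDense.F`, `I := IF`, `J := JF`, `C :=` the max of the five thresholds and `1`,
`K :=` the max of the four constants and `7`; every clause is monotone in `K` because the main and
error terms are non-negative once `𝔖_B(𝓛) > 0`, `I_k > 0`, `J_k ≥ 0` and `R ≥ 1`). So the single
remaining input of the DAG is replaced by four independently attackable leaves, each with a fixed
typed target, next to the analytic kit already in the tree (`Maynard2016DenseClustersTestFunction`
§§11–14: (8.7)–(8.8), `F_anti`, `profExt`; `Maynard2016DenseClustersSmoothedSums`: Lemma 8.3).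

## References
* J. Maynard, *Dense clusters of primes in subsets*, Compositio Math. 152 (2016), Prop. 6.1,
  Lemmas 8.1, 8.5, 8.6, Props. 9.1, 9.2, 9.4, Lemma 9.3 [Maynard2016DenseClusters].
* K. Ford, B. Green, S. Konyagin, J. Maynard, T. Tao, *Long gaps between primes*, JAMS 31 (2018),
  Theorem 6 and its proof, (7.10)–(7.15) [FordGreenKonyaginMaynardTao2018].
-/

noncomputable section

open Finset Filter

namespace Literature.NumberTheory.Sieve

open FGKMT2018

namespace FGKMT2018

/-- The common quantifier block of [FGKMT, Thm 6] / [Maynard, Prop. 6.1] at `𝒜 = ℤ`, `θ = 1/3`,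
verbatim as in `Maynard2016DenseClusters_prop61Z`: for all large `x`, every `B ∈ {1} ∪ primes` with
`B ≤ x`, every admissible non-degenerate family `𝓛 = (L_i)_{i<k}` with `C ≤ k ≤ log^{1/5} x`,
`|a_i| ≤ log x`, `|b_i| ≤ x log² x`, every scale `x/2 ≤ X ≤ x log² x` and level `X^{1/30} ≤ R ≤ X^{1/9}`,
the property `P B k 𝓛 X R` holds.
[cite: FordGreenKonyaginMaynardTao2018, Thm 6 pp. 21–22 (hypotheses); Maynard2016DenseClusters, Prop. 6.1 p. 9] -/
def Prop61Frame (C : ℕ) (P : ℕ → (k : ℕ) → (Fin k → ℤ × ℤ) → ℝ → ℝ → Prop) : Prop :=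
  ∀ᶠ x : ℕ in atTop, ∀ B : ℕ, (B = 1 ∨ B.Prime) → B ≤ x →
    ∀ (k : ℕ) (L : Fin k → ℤ × ℤ) (X R : ℝ), C ≤ k → (k : ℝ) ≤ Real.log x ^ ((1 : ℝ) / 5) →
      FormsAdmissible L → FormsNondegenerate L →
      (∀ i, |(((L i).1 : ℤ) : ℝ)| ≤ Real.log x ∧ |(((L i).2 : ℤ) : ℝ)| ≤ x * Real.log x ^ 2) →
      (x : ℝ) / 2 ≤ X → X ≤ x * Real.log x ^ 2 →
      X ^ ((1 : ℝ) / 30) ≤ R → R ≤ X ^ ((1 : ℝ) / 9) → P B k L X R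

/-- The frame is monotone in the threshold `C` and in the property.
[cite: FordGreenKonyaginMaynardTao2018, Thm 6 pp. 21–22 (the common hypotheses; monotonicity in the threshold)] -/
theorem Prop61Frame.mono {C C' : ℕ} {P Q : ℕ → (k : ℕ) → (Fin k → ℤ × ℤ) → ℝ → ℝ → Prop}
    (hC : C ≤ C') (hPQ : ∀ B k L X R, P B k L X R → Q B k L X R) (h : Prop61Frame C P) :
    Prop61Frame C' Q := by
  filter_upwards [h] with x hx
  exact fun B hB hBx k L X R hCk hk hadm hnd hcoef hX1 hX2 hR1 hR2 =>
    hPQ B k L X R (hx B hB hBx k L X R (hC.trans hCk) hk hadm hnd hcoef hX1 hX2 hR1 hR2)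

/-- Two framed properties hold simultaneously from the larger threshold on.
[cite: FordGreenKonyaginMaynardTao2018, Thm 6 pp. 21–22 (the common hypotheses; conjunction of clauses)] -/
theorem Prop61Frame.and {C C' : ℕ} {P Q : ℕ → (k : ℕ) → (Fin k → ℤ × ℤ) → ℝ → ℝ → Prop}
    (hP : Prop61Frame C P) (hQ : Prop61Frame C' Q) :
    Prop61Frame (max C C') fun B k L X R => P B k L X R ∧ Q B k L X R := by
  filter_upwards [hP, hQ] with x hxP hxQ
  exact fun B hB hBx k L X R hCk hk hadm hnd hcoef hX1 hX2 hR1 hR2 =>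
    ⟨hxP B hB hBx k L X R ((le_max_left _ _).trans hCk) hk hadm hnd hcoef hX1 hX2 hR1 hR2,
      hxQ B hB hBx k L X R ((le_max_right _ _).trans hCk) hk hadm hnd hcoef hX1 hX2 hR1 hR2⟩

/-- Non-negativity of `B/φ(B)`. [cite: FordGreenKonyaginMaynardTao2018, Thm 6 p. 21 (the factor B/φ(B))] -/
theorem bOverPhi_nonneg (B : ℕ) : 0 ≤ bOverPhi B := by
  unfold bOverPhi; positivity

/-- Non-negativity of the main term of (7.12) when `𝔖_B(𝓛) ≥ 0`, `log R ≥ 0`, `I ≥ 0`.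
[cite: FordGreenKonyaginMaynardTao2018, Thm 6 (7.12) p. 21 (the main term is non-negative)] -/
theorem mainTermA_nonneg {k : ℕ} {L : Fin k → ℤ × ℤ} {B : ℕ} {X R I : ℝ}
    (hS : 0 ≤ singSeriesExcl L B) (hR : 0 ≤ Real.log R) (hI : 0 ≤ I) :
    0 ≤ mainTermA L B X R I := by
  unfold mainTermA
  have := bOverPhi_nonneg B
  positivity

/-- Non-negativity of the main term of (7.13) when `𝔖_B(𝓛) ≥ 0`, `log R ≥ 0`, `J ≥ 0`.
[cite: FordGreenKonyaginMaynardTao2018, Thm 6 (7.13) p. 21 (the main term is non-negative)] -/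
theorem mainTermB_nonneg {k : ℕ} {L : Fin k → ℤ × ℤ} {B : ℕ} {X R J : ℝ} (i : Fin k)
    (hS : 0 ≤ singSeriesExcl L B) (hR : 0 ≤ Real.log R) (hJ : 0 ≤ J) :
    0 ≤ mainTermB L B X R J i := by
  unfold mainTermB
  have := bOverPhi_nonneg B
  positivity

/-- Non-negativity of the secondary term of (7.13)/(7.14) when `𝔖_B(𝓛) ≥ 0`, `log R ≥ 0`, `I ≥ 0`.
[cite: FordGreenKonyaginMaynardTao2018, Thm 6 (7.13)–(7.14) pp. 21–22 (the error term is non-negative)] -/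
theorem errTermB_nonneg {k : ℕ} {L : Fin k → ℤ × ℤ} {B : ℕ} {X R I : ℝ}
    (hS : 0 ≤ singSeriesExcl L B) (hR : 0 ≤ Real.log R) (hI : 0 ≤ I) :
    0 ≤ errTermB L B X R I := by
  unfold errTermB
  have := bOverPhi_nonneg B
  positivity

end FGKMT2018

/-- **[Maynard2016DenseClusters, Proposition 9.1]** for `𝒜 = ℤ` (= [FGKMT, Thm 6 (7.12)]): with the
weights `w_n` of §7 built on `F = F_k` of (7.4),
`∑_{n ∈ 𝒜(X)} w_n = (1 + O(log^{−1/10} X)) (B/φ(B))^k 𝔖_B(𝓛) #𝒜(X) (log R)^k I_k(F)`,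
uniformly in the frame `FGKMT2018.Prop61Frame` (k ≥ C, implied constant K absolute).
Printed proof: split `𝒜(X)` into residue classes mod `W = ∏_{p ≤ 2k², p ∤ B} p` and mod `[d,e]`,
Hypothesis 1 (1),(3) for `ℤ` (`FGKMT2018ResidueClassCount`), the change of variables (8.1) and the
`r`-fold smoothed sums of Lemma 8.4 (via Lemmas 8.2, 8.3), error terms by Lemma 8.5 (i)–(ii) and
Lemma 8.6 (`I_k(F₁) ≪ … I_k(F)`).
[cite: Maynard2016DenseClusters, Prop. 9.1 pp. 19–20; FordGreenKonyaginMaynardTao2018, Thm 6 (7.12) p. 21] -/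
def Maynard2016DenseClusters_prop91Z : Prop :=
  ∃ (C : ℕ) (K : ℝ), 0 < K ∧ FGKMT2018.Prop61Frame C fun B k L X R =>
    |∑ n ∈ dyadZ X, sieveWt L B R (MaynardDense.F k) n - mainTermA L B X R (MaynardDense.IF k)|
      ≤ K / Real.log X ^ ((1 : ℝ) / 10) * mainTermA L B X R (MaynardDense.IF k)

/-- **[Maynard2016DenseClusters, Proposition 9.2 with Lemma 9.3, case `(a_L, B) = 1`]** for `𝒜 = ℤ`,
`𝒫` = all primes (= [FGKMT, Thm 6 (7.13)]): for every `C_H > 0` there are `C, K` such that, in the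
frame, for every form `L_i = a_i n + b_i` of `𝓛` with `(a_i, B) = 1`, `L_i > R` on `𝒜(X)`, and
Hypothesis 1 (2) for `L_i` at `θ = 1/3` with constant `C_H` (`HypothesisOneZ (1/3) B k X L_i C_H`),
`∑_{n ∈ 𝒜(X)} 1_𝒫(L_i(n)) w_n = (1 + O(log^{−1/10} X)) (φ(|a_i|)/|a_i|) (B/φ(B))^{k−1} 𝔖_B(𝓛)
#𝒫_{L_i}(X) (log R)^{k+1} J_k(F) + O((B/φ(B))^k 𝔖_B(𝓛) #𝒜(X) (log R)^{k−1} I_k(F))`.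
Printed proof: as Prop. 9.1 with the primality of `L_i(n) = W[d_m,e_m]·(…)` forcing `d_m = e_m = 1`,
the moduli `q = W[d,e] ≤ R² W < X^{1/3}` handled by Hypothesis 1 (2), the main term through
`y^{(m)}_r` (Lemma 9.3) and the slice integral `∫_{t_m = 0} F₂² ≪ k² T_k² J_k^{(m)}(F)`
(`MaynardDense.sliceI_F₂_le'`).
[cite: Maynard2016DenseClusters, Prop. 9.2 and Lemma 9.3 pp. 20–23; FordGreenKonyaginMaynardTao2018, Thm 6 (7.13) p. 21] -/
def Maynard2016DenseClusters_prop92Z : Prop :=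
  ∀ C_H : ℝ, 0 < C_H → ∃ (C : ℕ) (K : ℝ), 0 < K ∧ FGKMT2018.Prop61Frame C fun B k L X R =>
    ∀ i : Fin k, Nat.Coprime (L i).1.natAbs B → (∀ n ∈ dyadZ X, R < (formEval (L i) n : ℝ)) →
      HypothesisOneZ ((1 : ℝ) / 3) B k X (L i) C_H →
      |∑ n ∈ (dyadZ X).filter (fun n => 0 < formEval (L i) n ∧ (formEval (L i) n).natAbs.Prime),
          sieveWt L B R (MaynardDense.F k) n - mainTermB L B X R (MaynardDense.JF k) i|
        ≤ K / Real.log X ^ ((1 : ℝ) / 10) * mainTermB L B X R (MaynardDense.JF k) i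
            + K * errTermB L B X R (MaynardDense.IF k)

/-- **[Maynard2016DenseClusters, Proposition 9.4 at `ξ = θ/10 = 1/30`, `D = 1`]** for `𝒜 = ℤ`
(= [FGKMT, Thm 6 (7.14)]): in the frame, for every form `L₀ = a₀ n + b₀` with `a₀ ≠ 0`,
`|a₀|, |b₀| ≤ X²` and non-zero discriminant `Δ_{L₀} = |a₀| ∏_j |a₀ b_j − a_j b₀|` against `𝓛`,
`∑_{n ∈ 𝒜(X), L₀(n) prime > X^{1/30}} w_n ≤ K (Δ_{L₀}/φ(Δ_{L₀})) (B/φ(B))^k 𝔖_B(𝓛) #𝒜(X) (log R)^{k−1} I_k(F)`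
(primes `> X^{ξ}` have no prime factor `≤ X^{ξ}`, so `1_𝒫 ≤ 1_{𝒮(ξ;1)}`).
Printed proof: an upper-bound Selberg sieve in `k + 1` dimensions with the extra form `L₀` sifted to
`X^{ξ}`, Lemma 8.4 and Lemma 8.6.
[cite: Maynard2016DenseClusters, Prop. 9.4 pp. 24–26; FordGreenKonyaginMaynardTao2018, Thm 6 (7.14) p. 22] -/
def Maynard2016DenseClusters_prop94Z : Prop :=
  ∃ (C : ℕ) (K : ℝ), 0 < K ∧ FGKMT2018.Prop61Frame C fun B k L X R =>
    ∀ l₀ : ℤ × ℤ, l₀.1 ≠ 0 → |((l₀.1 : ℤ) : ℝ)| ≤ X ^ 2 → |((l₀.2 : ℤ) : ℝ)| ≤ X ^ 2 →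
      (∀ j, l₀.1 * (L j).2 - (L j).1 * l₀.2 ≠ 0) →
      ∑ n ∈ (dyadZ X).filter (fun n => 0 < formEval l₀ n ∧ (formEval l₀ n).natAbs.Prime ∧
          X ^ ((1 : ℝ) / 30) < (formEval l₀ n : ℝ)), sieveWt L B R (MaynardDense.F k) n
        ≤ K * ((discDelta L l₀ : ℝ) / Nat.totient (discDelta L l₀)) *
            errTermB L B X R (MaynardDense.IF k)

/-- **[Maynard2016DenseClusters, Lemma 8.5 (iii)]** for the weights of §7 on `F = F_k`
(= [FGKMT, Thm 6 (7.15)] «`w(n) ≪ x^{2θ/3+o(1)}` for all `n ∈ ℤ`»): `w_n ≪ R^{2+o(1)}`, rendered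
with `R ≤ X^{1/9}` as: for every `ε > 0`, in the frame (from a threshold `C` on), `w_n ≤ X^{2/9+ε}` for
every integer `n`. Printed proof: `|λ_d| ≪ k^{−k} (log R)^k` (Lemma 8.5 (i), from Lemma 8.4 and
`F` decreasing in each argument) and the divisor bound for the number of `d, e` with `[d_i,e_i] ∣ L_i(n)`.
[cite: Maynard2016DenseClusters, Lemma 8.5 (iii) p. 17; FordGreenKonyaginMaynardTao2018, Thm 6 (7.15) p. 22] -/
def Maynard2016DenseClusters_lemma85iiiZ : Prop :=
  ∃ C : ℕ, ∀ ε : ℝ, 0 < ε → FGKMT2018.Prop61Frame C fun B k L X R =>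
    ∀ n : ℤ, sieveWt L B R (MaynardDense.F k) n ≤ X ^ ((2 : ℝ) / 9 + ε)

/-- **Proposition 6.1 for `𝒜 = ℤ` from its printed parts** ([FGKMT, proof of Thm 6, p. 22]):
Props. 9.1, 9.2 (case `(a_L,B)=1`), 9.4 (`ξ = 1/30, D = 1`) and Lemma 8.5 (iii) of [Maynard] — the four
named leaves above — together with the tree's Lemma 8.1 (`exp_neg_seven_mul_le_singSeriesExcl`:
`𝔖_B(𝓛) ≥ e^{−7k}`) and Lemma 8.6 (`MaynardDense.exists_IF_JF_bounds`) give
`Maynard2016DenseClusters_prop61Z` with `F := MaynardDense.F`, `I := MaynardDense.IF`,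
`J := MaynardDense.JF`, `C` the largest of the thresholds and `K` the largest of the constants
(each clause is monotone in `K`: the main/error terms are non-negative since `𝔖_B(𝓛) > 0`, `I_k > 0`,
`J_k ≥ 0`, `log R ≥ 0`).
[cite: FordGreenKonyaginMaynardTao2018, Thm 6, proof p. 22; Maynard2016DenseClusters, Prop. 6.1 p. 9] -/
theorem maynard2016_prop61Z_of_parts (h91 : Maynard2016DenseClusters_prop91Z)
    (h92 : Maynard2016DenseClusters_prop92Z) (h94 : Maynard2016DenseClusters_prop94Z)
    (h85 : Maynard2016DenseClusters_lemma85iiiZ) : Maynard2016DenseClusters_prop61Z := by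
  intro C_H hCH
  obtain ⟨C₁, K₁, hK₁, h1⟩ := h91
  obtain ⟨C₂, K₂, hK₂, h2⟩ := h92 C_H hCH
  obtain ⟨C₃, K₃, hK₃, h3⟩ := h94
  obtain ⟨C₄, h4⟩ := h85
  obtain ⟨C₀, K₀, hK₀, h0⟩ := MaynardDense.exists_IF_JF_bounds
  set C : ℕ := max (max C₀ 1) (max (max C₁ C₂) (max C₃ C₄)) with hCdef
  set K : ℝ := max (max K₀ 7) (max (max K₁ K₂) K₃) with hKdef
  have hC₀ : C₀ ≤ C := le_trans (le_max_left C₀ 1) (le_max_left _ _)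
  have hC1 : 1 ≤ C := le_trans (le_max_right C₀ 1) (le_max_left _ _)
  have hC₁ : C₁ ≤ C :=
    le_trans (le_trans (le_max_left C₁ C₂) (le_max_left _ (max C₃ C₄))) (le_max_right _ _)
  have hC₂ : C₂ ≤ C :=
    le_trans (le_trans (le_max_right C₁ C₂) (le_max_left _ (max C₃ C₄))) (le_max_right _ _)
  have hC₃ : C₃ ≤ C :=
    le_trans (le_trans (le_max_left C₃ C₄) (le_max_right (max C₁ C₂) _)) (le_max_right _ _)
  have hC₄ : C₄ ≤ C :=
    le_trans (le_trans (le_max_right C₃ C₄) (le_max_right (max C₁ C₂) _)) (le_max_right _ _)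
  have hK₀K : K₀ ≤ K := le_trans (le_max_left K₀ 7) (le_max_left _ _)
  have h7K : (7 : ℝ) ≤ K := le_trans (le_max_right K₀ 7) (le_max_left _ _)
  have hK₁K : K₁ ≤ K := le_trans (le_trans (le_max_left K₁ K₂) (le_max_left _ K₃)) (le_max_right _ _)
  have hK₂K : K₂ ≤ K :=
    le_trans (le_trans (le_max_right K₁ K₂) (le_max_left _ K₃)) (le_max_right _ _)
  have hK₃K : K₃ ≤ K := le_trans (le_max_right (max K₁ K₂) K₃) (le_max_right _ _)
  have hKpos : 0 < K := lt_of_lt_of_le hK₀ hK₀K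
  -- `J_k ≥ 0` and `(log k/k) I_k ≥ 0` from the Lemma 8.6 block
  have hIJ : ∀ k, C ≤ k → 0 < MaynardDense.IF k ∧ 0 ≤ Real.log k / k * MaynardDense.IF k ∧
      0 ≤ MaynardDense.JF k := by
    intro k hk
    obtain ⟨hI, -, hJ1, -⟩ := h0 k (hC₀.trans hk)
    have hk1 : (1 : ℝ) ≤ k := by exact_mod_cast hC1.trans hk
    have hlk : 0 ≤ Real.log k / k * MaynardDense.IF k := by
      have := Real.log_nonneg hk1
      positivity
    have hJ0 : 0 ≤ MaynardDense.JF k := by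
      have h := hlk.trans hJ1
      by_contra hneg
      have : K₀ * MaynardDense.JF k < 0 := mul_neg_of_pos_of_neg hK₀ (not_le.1 hneg)
      linarith
    exact ⟨hI, hlk, hJ0⟩
  refine ⟨C, K, MaynardDense.F, MaynardDense.IF, MaynardDense.JF, hKpos, ?_, ?_⟩
  · intro k hk
    obtain ⟨hI, hI2, hJ1, hJ2⟩ := h0 k (hC₀.trans hk)
    obtain ⟨-, hlk, hJ0⟩ := hIJ k hk
    exact ⟨hI, hI2.trans (mul_le_mul_of_nonneg_right hK₀K hI.le),
      hJ1.trans (mul_le_mul_of_nonneg_right hK₀K hJ0),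
      hJ2.trans (mul_le_mul_of_nonneg_right hK₀K hlk)⟩
  · intro ε hε
    filter_upwards [h1, h2, h3, h4 ε hε, eventually_ge_atTop 2] with x hx1 hx2 hx3 hx4 hx_ge
    intro B hB hBx k L X R hCk hk hadm hnd hcoef hX1 hX2 hR1 hR2
    have hk1 : 1 ≤ k := hC1.trans hCk
    have hx2' : (2 : ℝ) ≤ x := by exact_mod_cast hx_ge
    have hX1' : 1 ≤ X := by linarith
    have hR1' : 1 ≤ R := le_trans (Real.one_le_rpow hX1' (by norm_num)) hR1
    have hlogR : 0 ≤ Real.log R := Real.log_nonneg hR1'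
    have hlogX : 0 ≤ Real.log X := Real.log_nonneg hX1'
    have hr : 0 ≤ Real.log X ^ ((1 : ℝ) / 10) := Real.rpow_nonneg hlogX _
    have hS7 := exp_neg_seven_mul_le_singSeriesExcl hadm hnd hk1 B
    have hS0 : 0 ≤ singSeriesExcl L B := (Real.exp_pos _).le.trans hS7
    obtain ⟨hI, -, hJ0⟩ := hIJ k hCk
    have hMA := mainTermA_nonneg (X := X) hS0 hlogR hI.le
    have hMB := fun i : Fin k => mainTermB_nonneg (X := X) i hS0 hlogR hJ0
    have hEB := errTermB_nonneg (X := X) hS0 hlogR hI.le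
    have e1 := hx1 B hB hBx k L X R (hC₁.trans hCk) hk hadm hnd hcoef hX1 hX2 hR1 hR2
    have e2 := hx2 B hB hBx k L X R (hC₂.trans hCk) hk hadm hnd hcoef hX1 hX2 hR1 hR2
    have e3 := hx3 B hB hBx k L X R (hC₃.trans hCk) hk hadm hnd hcoef hX1 hX2 hR1 hR2
    have e4 := hx4 B hB hBx k L X R (hC₄.trans hCk) hk hadm hnd hcoef hX1 hX2 hR1 hR2
    refine ⟨?_, ?_, ?_, ?_, e4⟩
    · refine le_trans (Real.exp_le_exp.2 ?_) hS7
      have : (7 : ℝ) * k ≤ K * k := mul_le_mul_of_nonneg_right h7K (Nat.cast_nonneg k)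
      linarith
    · exact e1.trans (mul_le_mul_of_nonneg_right (div_le_div_of_nonneg_right hK₁K hr) hMA)
    · intro i hcop hRi hH
      exact (e2 i hcop hRi hH).trans (add_le_add
        (mul_le_mul_of_nonneg_right (div_le_div_of_nonneg_right hK₂K hr) (hMB i))
        (mul_le_mul_of_nonneg_right hK₂K hEB))
    · intro l₀ ha hl1 hl2 hdisc
      refine (e3 l₀ ha hl1 hl2 hdisc).trans ?_
      have hΔ : 0 ≤ ((discDelta L l₀ : ℝ) / Nat.totient (discDelta L l₀)) := by positivity
      exact mul_le_mul_of_nonneg_right (mul_le_mul_of_nonneg_right hK₃K hΔ) hEB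

end Literature.NumberTheory.Sieve
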